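import Mathlib.Topology.ContinuousMap.Basic
import Mathlib.Topology.CompactOpen
import Mathlib.Topology.UnitInterval
import Mathlib.Topology.MetricSpace.Thickening
import Mathlib.MeasureTheory.Constructions.BorelSpace.Basic
import Mathlib.Topology.Instances.NNReal.Lemmas
import HarnessLib

/-!
# Initial segments of a path, rescaled to unit time; the event "the path stays in `V` up to time `u`"

Topic `Probability/Process`; two small path-space notions used to read statements about a
*killed* continuous path `p : C(ℝ≥0, E)` (killed on leaving an open set `V`) as functionals of
the whole path:

* `scaleI u : C([0,1], ℝ≥0)` — `v ↦ u·v`; `pathSeg p u : C([0,1], E)` — **the initial segment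
  `p|[0,u]` in unit time**, `v ↦ p(u v)`; `continuous_pathSeg` — jointly continuous in `(p, u)`
  (composition in the compact-open topology, `ℝ≥0` being locally compact);
* `staysIn V = {(p, u) | p([0, u]) ⊆ V}`; `isOpen_staysIn` — **open for `V` open** (a compact
  piece of path inside `V` stays inside under small perturbations of the path and of the time),
  hence Borel (`measurableSet_staysIn`).

For a path started in `V`, `(p, u) ∈ staysIn V` says that `u` is (strictly) before the exit time
of `V`; integrating `𝟙_{staysIn V}(p, u) Ψ(pathSeg p u, u) du` thus integrates `Ψ` over the killed
path (Lawler (2005), §2.4 / §5.1: measures on paths killed on leaving a domain).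

## References

* G. F. Lawler, *Conformally Invariant Processes in the Plane*, AMS (2005), §5.1 (paths
  `γ : [0, t_γ] → ℂ`, killed measures `μ_D`).
* P. Billingsley, *Convergence of Probability Measures* (1999), §7 (random elements of `C`).
-/

noncomputable section

open Set Filter Topology
open scoped unitInterval NNReal

namespace Literature.Probability.Process

variable {E : Type*} [TopologicalSpace E]

/-! ### Rescaled initial segments -/

/-- Multiplication `(u, v) ↦ u·v : ℝ≥0 × [0,1] → ℝ≥0` as a continuous map. [folklore] -/
def scaleMap : C(ℝ≥0 × I, ℝ≥0) :=
  ⟨fun x ↦ x.1 * (x.2 : ℝ).toNNReal,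
    continuous_fst.mul (continuous_real_toNNReal.comp (continuous_subtype_val.comp continuous_snd))⟩

/-- **The time scaling `v ↦ u·v`** from `[0,1]` onto `[0,u]`, as a continuous map depending
continuously on `u` (`ContinuousMap.curry`). [folklore] -/
def scaleI (u : ℝ≥0) : C(I, ℝ≥0) := scaleMap.curry u

/-- Value of the time scaling. [folklore] -/
theorem scaleI_apply (u : ℝ≥0) (v : I) : scaleI u v = u * (v : ℝ).toNNReal := rfl

/-- Value of the time scaling, in `ℝ`. [folklore] -/
theorem coe_scaleI_apply (u : ℝ≥0) (v : I) : ((scaleI u v : ℝ≥0) : ℝ) = u * v := by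
  rw [scaleI_apply, NNReal.coe_mul, Real.coe_toNNReal _ v.2.1]

/-- `u ↦ scaleI u` is continuous into `C([0,1], ℝ≥0)`. [folklore] -/
theorem continuous_scaleI : Continuous scaleI := scaleMap.curry.continuous

/-- The scaling reaches at most `u`. [folklore] -/
theorem scaleI_le (u : ℝ≥0) (v : I) : scaleI u v ≤ u := by
  rw [← NNReal.coe_le_coe, coe_scaleI_apply]
  calc (u : ℝ) * v ≤ u * 1 := mul_le_mul_of_nonneg_left v.2.2 u.coe_nonneg
    _ = u := mul_one _

/-- The scaling at `v = 1` is `u`. [folklore] -/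
@[simp] theorem scaleI_one (u : ℝ≥0) : scaleI u 1 = u := by
  apply NNReal.eq; rw [coe_scaleI_apply]; simp

/-- The scaling at `v = 0` is `0`. [folklore] -/
@[simp] theorem scaleI_zero (u : ℝ≥0) : scaleI u 0 = 0 := by
  apply NNReal.eq; rw [coe_scaleI_apply]; simp

/-- **The initial segment `p|[0,u]` of a path, in unit time**: `v ↦ p(u·v)`. [folklore] -/
def pathSeg (p : C(ℝ≥0, E)) (u : ℝ≥0) : C(I, E) := p.comp (scaleI u)

/-- Value of the segment. [folklore] -/
@[simp] theorem pathSeg_apply (p : C(ℝ≥0, E)) (u : ℝ≥0) (v : I) : pathSeg p u v = p (scaleI u v) := rfl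

/-- **The segment depends continuously on `(path, time)`** (compact-open topologies).
[folklore] -/
theorem continuous_pathSeg : Continuous fun x : C(ℝ≥0, E) × ℝ≥0 ↦ pathSeg x.1 x.2 := by
  have h : (fun x : C(ℝ≥0, E) × ℝ≥0 ↦ pathSeg x.1 x.2) =
      (fun y : C(I, ℝ≥0) × C(ℝ≥0, E) ↦ y.2.comp y.1) ∘ fun x ↦ (scaleI x.2, x.1) := rfl
  rw [h]
  exact ContinuousMap.continuous_comp'.comp ((continuous_scaleI.comp continuous_snd).prodMk continuous_fst)

/-- The segment is continuous in the path for a fixed time. [folklore] -/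
theorem continuous_pathSeg_left (u : ℝ≥0) : Continuous fun p : C(ℝ≥0, E) ↦ pathSeg p u :=
  continuous_pathSeg.comp (continuous_id.prodMk continuous_const)

/-- The range of a segment is the image of `[0, u]`. [folklore] -/
theorem range_pathSeg_subset (p : C(ℝ≥0, E)) (u : ℝ≥0) : range (pathSeg p u) ⊆ p '' Icc 0 u := by
  rintro _ ⟨v, rfl⟩
  exact ⟨scaleI u v, ⟨bot_le, scaleI_le u v⟩, rfl⟩

/-! ### Staying in a set up to a time -/

/-- **`staysIn V = {(p, u) | p([0,u]) ⊆ V}`**: the path stays in `V` up to time `u` (for a path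
started in an open `V`: `u` is before the exit time of `V`). [folklore] -/
def staysIn (V : Set E) : Set (C(ℝ≥0, E) × ℝ≥0) := {x | MapsTo x.1 (Icc 0 x.2) V}

/-- Membership in `staysIn`. [folklore] -/
theorem mem_staysIn {V : Set E} {p : C(ℝ≥0, E)} {u : ℝ≥0} :
    (p, u) ∈ staysIn V ↔ ∀ r, r ≤ u → p r ∈ V := by
  simp only [staysIn, mem_setOf_eq, MapsTo, mem_Icc, zero_le, true_and]

/-- `staysIn` is monotone in the set. [folklore] -/
theorem staysIn_mono {V V' : Set E} (h : V ⊆ V') : staysIn V ⊆ staysIn V' :=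
  fun _ hx ↦ hx.mono_right h

/-- `staysIn` is anti-monotone in the time. [folklore] -/
theorem mem_staysIn_of_le {V : Set E} {p : C(ℝ≥0, E)} {u u' : ℝ≥0} (h : (p, u) ∈ staysIn V)
    (hle : u' ≤ u) : (p, u') ∈ staysIn V :=
  mem_staysIn.2 fun r hr ↦ mem_staysIn.1 h r (hr.trans hle)

/-- On `staysIn V` the segment lies in `V`. [folklore] -/
theorem range_pathSeg_subset_of_mem_staysIn {V : Set E} {p : C(ℝ≥0, E)} {u : ℝ≥0}
    (h : (p, u) ∈ staysIn V) : range (pathSeg p u) ⊆ V :=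
  (range_pathSeg_subset p u).trans (mapsTo_iff_image_subset.1 h)

/-- **`staysIn V` is open for `V` open.** If `p([0,u]) ⊆ V`, some thickening `[0, u + δ]` is
still mapped into `V` (compactness), and then so is `[0, u']`, `u' < u + δ`, by every path
uniformly close to `p` on `[0, u + δ]` (`ContinuousMap.isOpen_setOf_mapsTo`). [folklore] -/
theorem isOpen_staysIn {V : Set E} (hV : IsOpen V) : IsOpen (staysIn V) := by
  rw [isOpen_iff_mem_nhds]
  rintro ⟨p, u⟩ hpu
  -- a thickening of `[0, u]` inside `p⁻¹ V`
  have hA : IsOpen (p ⁻¹' V) := hV.preimage p.continuous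
  have hsub : Icc (0 : ℝ≥0) u ⊆ p ⁻¹' V := fun r hr ↦ hpu hr
  obtain ⟨δ, hδ, hthick⟩ := isCompact_Icc.exists_cthickening_subset_open hA hsub
  obtain ⟨d, hd0, hdδ⟩ : ∃ d : ℝ≥0, 0 < d ∧ (d : ℝ) ≤ δ := ⟨⟨δ / 2, by positivity⟩, by
    show (0 : ℝ) < δ / 2; positivity, by show δ / 2 ≤ δ; linarith⟩
  have hsub' : Icc (0 : ℝ≥0) (u + d) ⊆ p ⁻¹' V := by
    intro r hr
    refine hthick ?_
    rcases le_total r u with h | h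
    · exact Metric.self_subset_cthickening _ ⟨hr.1, h⟩
    · refine Metric.mem_cthickening_of_dist_le r u δ _ (right_mem_Icc.2 bot_le) ?_
      rw [NNReal.dist_eq, abs_of_nonneg (sub_nonneg.2 (NNReal.coe_le_coe.2 h))]
      have : (r : ℝ) ≤ u + d := by exact_mod_cast hr.2
      linarith
  -- the neighbourhood
  have hN : IsOpen {q : C(ℝ≥0, E) | MapsTo q (Icc 0 (u + d)) V} :=
    ContinuousMap.isOpen_setOf_mapsTo isCompact_Icc hV
  have hmem : (p, u) ∈ {q : C(ℝ≥0, E) | MapsTo q (Icc 0 (u + d)) V} ×ˢ Iio (u + d) :=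
    ⟨fun r hr ↦ hsub' hr, by simp [hd0]⟩
  refine mem_of_superset ((hN.prod isOpen_Iio).mem_nhds hmem) ?_
  rintro ⟨q, u'⟩ ⟨hq, hu'⟩
  exact fun r hr ↦ hq ⟨hr.1, hr.2.trans (le_of_lt hu')⟩

section Measurable

variable [MeasurableSpace C(ℝ≥0, E)] [BorelSpace C(ℝ≥0, E)]

/-- `staysIn V` is Borel for `V` open. [folklore] -/
theorem measurableSet_staysIn {V : Set E} (hV : IsOpen V) : MeasurableSet (staysIn V) :=
  (isOpen_staysIn hV).measurableSet

/-- The segment map is Borel measurable (jointly). [folklore] -/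
theorem measurable_pathSeg [MeasurableSpace C(I, E)] [BorelSpace C(I, E)] :
    Measurable fun x : C(ℝ≥0, E) × ℝ≥0 ↦ pathSeg x.1 x.2 :=
  continuous_pathSeg.measurable

end Measurable

end Literature.Probability.Process

end
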